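import Summits.HodgeConjecture.HodgeConjecture.Theorems.R90S4EquivariantFamilyRadialMeasure   -- ★ p864068 (this seat) M2: `polishSpace_quotient_prod_param`, `measurableSet_regularSet_equivariantFamily`, `exists_radial_prod_eq_fibreCount_equivariantFamily`; brings ★ `FibreCountPullback`, ★ `InvariantQuotientExistence` (`quotientMeasure`)
import Summits.HodgeConjecture.HodgeConjecture.Theorems.F0P3cStCharTSWeylHypJacobian          -- ★ p849811 §1 (generic): `restrict_eq_restrict_of_forall_nhds`; brings ★ p849733 §2 (generic): `integrable_and_integral_eq_smul_of_lintegral_radial`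
import HarnessLib

/-!
# R90-TF · S4 «Ch. 13.1–2», T-WIF road, head M2♭ (abstract) — FROM A LOCAL TUBE JACOBIAN TO THE WEIGHTED RADIAL FORMULA, for any equivariant finite-fibre family
# `Ψ : G ⧸ B × S → G` and any reference measure on the parameter space (Harish-Chandra 1970, Lemmas 22 ∕ 42; Rogawski 1990, §12.5 pp. 182, 186)

Cell `hodgecm-mathlib`, crux H413 (`stmt-HodgeConjecture-24833`, lane `--supports … --as helper`), route of record `HCCMUnconditional` (no route verbs;
count-neutral).  Programme R90-TF, section S4 = [Rogawski1990] Ch. 13.1–13.2; seat R90-C131-p03 (g3); the local-to-global step between the ONE analytic letter (J̃♭) of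
`R90/R90-C131-p03/g3/HEADS-TWIF-tube.v3-M1M2.md` (PLAN OF RECORD, S4-R30) and the (B1) assembly: GENERIC — no S4 token — twin of ★ (E1b)
`F0P3cStCharTSWeylCartanJacobian.lintegral_cartanSet_eq_of_tubeJacobian_local` with the torus factor abstracted to any lcsc space `S`, the conjugation twisted (★ M2
`R90S4EquivariantFamilyRadialMeasure`), and the Haar measure of the torus replaced by ANY σ-finite reference measure `λ` on `S` (at S4: `λ_T = N^* t_T`, the norm pull-back of the
Cartan measure, S4-R30).  THEOREMS ONLY — no `def`, no instance, no notation, no named-fact hypothesis, no `sorry`; ★-only imports.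

HONEST LABEL: HC_CM is proved only modulo the 7 printed citations (2 remaining named inputs: hLiu418 = stmt-HodgeConjecture-24832, h413 =
stmt-HodgeConjecture-24833) until rung 0 closes.  Pure measure theory; CONDITIONAL on the local tube Jacobian BY SHAPE (`hJac`); discharges no socket (REL ≠ ★ ≠ BUILT).

## The mathematics

SETTING = ★ M2's: `G` lcsc Hausdorff group, `ν` Haar and right invariant, `B ≤ G` closed with Haar `bm`, `μ₀ = ν ∕ bm` on `G ⧸ B`; `S` lcsc Hausdorff (parameters),
`Ψ : G ⧸ B × S → G` continuous with `Ψ(c • q, s) = c Ψ(q, s) e(c)`; `S₀ ⊆ S` Borel, `D = {(q, s) | s ∈ S₀}`; (LI) local injectivity on `D`; (FC) fibre count `w` over `Ψ(D)`.  NEW DATA: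
a σ-finite measure `λ` on `S` and a Borel weight `W : S → [0, ∞]`, with THE LOCAL TUBE JACOBIAN BY SHAPE
  (J♭) every `s₀ ∈ S₀` has an open `U ∋ s₀` and a Borel `A₀ ⊆ G ⧸ B` with `0 < μ₀(A₀) < ∞` and `Ψ` INJECTIVE on `(A₀ × U) ∩ D`, such that for every Borel `V ⊆ U ∩ S₀`:
  `ν(Ψ(A₀ × V)) = μ₀(A₀) · ∫_V W dλ`
(the injectivity clause replaces ★ (E1b)'s «`W`-free `V`»: by (LI) the payer can always shrink `A₀ × U` into an injectivity patch, and no continuity of a Weyl action on `S₀` is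
needed — essential at S4, where `S₀ = B₀` is only a Borel transversal).
* §1 `lintegral_image_eq_lintegral_weight_of_tubeJacobian_local`: **`w · ∫_{Ψ(D)} f dν = ∫_{s ∈ S₀} W(s) · ∫_{G ⧸ B} f(Ψ(q, s)) dμ₀(q) dλ(s)`** for Borel `f ≥ 0`.  Proof (★ (E1b)
  verbatim in the abstract currency): the fibre-count pull-back `μ` of `ν` and its Weil factorisation `μ = μ₀ ⊗ σ` (★ M2); on an injectivity patch every fibre meets `A₀ × V` at most
  once, so `μ₀(A₀) σ(V) = μ(A₀ × V) = ν(Ψ(A₀ × V)) = μ₀(A₀) ∫_V W dλ`, i.e. `σ = W · λ` near every point of `S₀`; ★ `restrict_eq_restrict_of_forall_nhds` globalises; `σ` is carried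
  by `S₀`.
* §2 `integrable_and_integral_eq_of_tubeJacobian_local`: the Bochner form (★ `integrable_and_integral_eq_smul_of_lintegral_radial`): for `g` `ν`-integrable on `Ψ(D)`,
  `(s, q) ↦ g(Ψ(q, s))` is `((W·λ)|_{S₀}) ⊗ μ₀`-integrable and `∫_{s ∈ S₀} W(s) • ∫_{G ⧸ B} g(Ψ(q, s)) dμ₀ dλ = w • ∫_{Ψ(D)} g dν` (real weight `W : S → ℝ≥0` here).
USE (S4).  `B = T′`, `S = T̃`, `S₀ = B₀`, `Ψ = Ψ_T`, `w = |W̃^ε_T|` (★ M1-TWIST), `λ = λ_T = N^* t_T`, `W = W_T` with the rider «`W_T = D_G(N ·)²` a.e.» (S4-R30 (b)): then (J̃♭) ⇒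
`|W̃^ε_T| ∫_{tube_T} φ β dνGt = ∫_{B₀} W_T(t) Φ_ε(⟦t⟧, φ) β(t) dλ_T(t)` (★ β CAN-ID for the inner integral), and ★ M4 pushes along the norm.

[cite: HarishChandra1970, Lemma 22; Lemma 42] [cite: Rogawski1990, §12.5 pp. 182, 186] [cite: Weil1965, n° 49 Lemme 22 (p. 70)] [cite: Federer1969, §2.10.10]
-/

set_option autoImplicit false
-- the mandated namespace repeats the single-problem summit's segment (`HodgeConjecture.HodgeConjecture`)
set_option linter.dupNamespace false

noncomputable section

open MeasureTheory Measure Set Filter Topology Function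
open scoped ENNReal NNReal Pointwise

namespace Summit.HodgeConjecture.HodgeConjecture.R90.S4

open Literature.MeasureTheory.Group
open Summit.HodgeConjecture.HodgeConjecture.Cruxes.H413.F0P3cStCharTSWeylHypJacobian (restrict_eq_restrict_of_forall_nhds)
open Summit.HodgeConjecture.HodgeConjecture.Cruxes.H413.F0P3cStCharTSWeylHypMeasure (integrable_and_integral_eq_smul_of_lintegral_radial)

section TubeJacobian

variable {G : Type*} [Group G] [TopologicalSpace G] [IsTopologicalGroup G] [LocallyCompactSpace G]
  [SecondCountableTopology G] [T2Space G] [MeasurableSpace G] [BorelSpace G]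
  (B : Subgroup G) (hB : IsClosed (B : Set G))
  [MeasurableSpace (G ⧸ B)] [BorelSpace (G ⧸ B)]
  (ν : Measure G) [ν.IsHaarMeasure] [ν.IsMulRightInvariant]
  {S : Type*} [TopologicalSpace S] [LocallyCompactSpace S] [SecondCountableTopology S] [T2Space S] [MeasurableSpace S] [BorelSpace S]
  (Ψ : (G ⧸ B) × S → G) (hΨc : Continuous Ψ) (e : G → G) (hΨ : ∀ (c : G) (q : G ⧸ B) (s : S), Ψ (c • q, s) = c * Ψ (q, s) * e c)
  (S₀ : Set S) (hS₀ : MeasurableSet S₀)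
  (hinj : ∀ z ∈ {p : (G ⧸ B) × S | p.2 ∈ S₀}, ∃ U : Set ((G ⧸ B) × S), IsOpen U ∧ z ∈ U ∧ InjOn Ψ (U ∩ {p : (G ⧸ B) × S | p.2 ∈ S₀}))
  (w : ℕ) (hw : ∀ y ∈ Ψ '' {p : (G ⧸ B) × S | p.2 ∈ S₀}, Measure.count (Ψ ⁻¹' {y} ∩ {p : (G ⧸ B) × S | p.2 ∈ S₀}) = (w : ℝ≥0∞))
  (bm : Measure B) [bm.IsMulLeftInvariant] [IsFiniteMeasureOnCompacts bm] [bm.IsOpenPosMeasure] [bm.IsInvInvariant]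
  (lam : Measure S) (W : S → ℝ≥0∞) (hW : Measurable W)

/-! ## §1 Local tube Jacobian ⇒ the radial measure is `W · λ` on `S₀` ⇒ the weighted radial formula -/

include hΨc hΨ hS₀ hinj hw hW in
/-- **LOCAL TUBE JACOBIAN ⇒ WEIGHTED WEYL INTEGRATION FORMULA ON `Ψ(D)` — for any equivariant finite-fibre family and any reference measure.**  In the setting of ★ M2
(`Ψ(c • q, s) = c Ψ(q, s) e(c)`, (LI), (FC) with count `w`, `μ₀ = ν ∕ bm`), let `λ` be σ-finite on `S` and `W : S → [0, ∞]` Borel, and assume the LOCAL TUBE JACOBIAN BY SHAPE: every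
`s₀ ∈ S₀` has an open `U ∋ s₀` and a Borel `A₀ ⊆ G ⧸ B`, `0 < μ₀(A₀) < ∞`, with `Ψ` injective on `(A₀ × U) ∩ D`, such that `ν(Ψ(A₀ × V)) = μ₀(A₀) · ∫⁻_V W dλ` for every Borel
`V ⊆ U ∩ S₀`.  THEN for every Borel `f ≥ 0`:  **`w · ∫⁻_{Ψ(D)} f dν = ∫⁻_{s ∈ S₀} W(s) · ∫⁻_{G ⧸ B} f(Ψ(q, s)) dμ₀(q) dλ(s)`**.  (★ (E1b) is the case `S = T`, `Ψ = x t x⁻¹`,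
`λ = tm`, `W = D`; the twisted tube of the plan of record is `S = T̃`, `S₀ = B₀`, `λ = N^* t_T`, `W = W_T`.) [cite: HarishChandra1970, Lemma 22; Lemma 42] [cite: Rogawski1990, §12.5 pp. 182, 186]
[cite: Weil1965, n° 49 Lemme 22 (p. 70)] [cite: Federer1969, §2.10.10] -/
theorem lintegral_image_eq_lintegral_weight_of_tubeJacobian_local
    (hJac : ∀ s₀ ∈ S₀, ∃ U : Set S, IsOpen U ∧ s₀ ∈ U ∧
      ∃ A₀ : Set (G ⧸ B), MeasurableSet A₀ ∧ (quotientMeasure B bm hB ν) A₀ ≠ 0 ∧ (quotientMeasure B bm hB ν) A₀ ≠ ⊤ ∧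
        InjOn Ψ ((A₀ ×ˢ U) ∩ {p : (G ⧸ B) × S | p.2 ∈ S₀}) ∧
        ∀ V : Set S, MeasurableSet V → V ⊆ U ∩ S₀ →
          ν (Ψ '' (A₀ ×ˢ V)) = (quotientMeasure B bm hB ν) A₀ * ∫⁻ s in V, W s ∂lam) :
    ∀ f : G → ℝ≥0∞, Measurable f →
      (w : ℝ≥0∞) * ∫⁻ y in Ψ '' {p : (G ⧸ B) × S | p.2 ∈ S₀}, f y ∂ν =
        ∫⁻ s in S₀, W s * ∫⁻ q, f (Ψ (q, s)) ∂(quotientMeasure B bm hB ν) ∂lam := by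
  classical
  -- §a topology ∕ measurability
  haveI : IsClosed (B : Set G) := hB
  haveI : PolishSpace ((G ⧸ B) × S) := polishSpace_quotient_prod_param B hB
  haveI : SecondCountableTopology (G ⧸ B) := (QuotientGroup.isQuotientMap_mk _).secondCountableTopology QuotientGroup.isOpenMap_coe
  haveI : LocallyCompactSpace (G ⧸ B) := QuotientGroup.instLocallyCompactSpace _
  haveI : SigmaCompactSpace (G ⧸ B) := sigmaCompactSpace_of_locallyCompact_secondCountable
  haveI : SigmaFinite (quotientMeasure B bm hB ν) := SigmaFinite.of_isFiniteMeasureOnCompacts _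
  have hDm := measurableSet_regularSet_equivariantFamily B S₀ hS₀
  -- §b the fibre-count pull-back `μ` of `ν` and its Weil factorisation `μ = μ₀ ⊗ σ`; the radial formula for this `σ`
  obtain ⟨μ, hμ⟩ := exists_measure_apply_eq_lintegral_count_fibre hDm hΨc hinj ν
  obtain ⟨σ, hσfin, hσsf, hσcar, hprod⟩ :=
    exists_radial_prod_eq_fibreCount_equivariantFamily B hB ν Ψ hΨc e hΨ S₀ hS₀ hinj w hw bm hμ
  haveI := hσsf
  have hformula : ∀ f : G → ℝ≥0∞, Measurable f →
      (w : ℝ≥0∞) * ∫⁻ y in Ψ '' {p : (G ⧸ B) × S | p.2 ∈ S₀}, f y ∂ν = ∫⁻ s, ∫⁻ q, f (Ψ (q, s)) ∂(quotientMeasure B bm hB ν) ∂σ := by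
    intro f hf
    have h1 := lintegral_comp_eq_mul_setLIntegral_image hDm hΨc hinj hμ hw hf
    rw [← hprod, lintegral_prod_symm (fun z : (G ⧸ B) × S => f (Ψ z)) (hf.comp hΨc.measurable).aemeasurable] at h1
    exact h1.symm
  -- §c evaluation on tubes inside an injectivity patch: `σ V = ∫⁻_V W dλ`
  have htube : ∀ A₀ : Set (G ⧸ B), MeasurableSet A₀ → (quotientMeasure B bm hB ν) A₀ ≠ 0 → (quotientMeasure B bm hB ν) A₀ ≠ ⊤ →
      ∀ U : Set S, InjOn Ψ ((A₀ ×ˢ U) ∩ {p : (G ⧸ B) × S | p.2 ∈ S₀}) →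
      ∀ V : Set S, MeasurableSet V → V ⊆ U ∩ S₀ →
      ν (Ψ '' (A₀ ×ˢ V)) = (quotientMeasure B bm hB ν) A₀ * ∫⁻ s in V, W s ∂lam → σ V = ∫⁻ s in V, W s ∂lam := by
    intro A₀ hA₀m hA₀0 hA₀top U hinjU V hVm hVU h3
    have hE : MeasurableSet (A₀ ×ˢ V) := hA₀m.prod hVm
    have hEsub : A₀ ×ˢ V ⊆ {p : (G ⧸ B) × S | p.2 ∈ S₀} := fun p hp => (hVU hp.2).2
    have hEim : MeasurableSet (Ψ '' (A₀ ×ˢ V)) := by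
      rw [← inter_eq_left.2 hEsub]; exact measurableSet_image_inter_of_locallyInjOn hDm hΨc hinj hE
    -- every fibre meets `A₀ × V` at most once (injectivity patch)
    have hsub : ∀ y, (Ψ ⁻¹' {y} ∩ (A₀ ×ˢ V ∩ {p : (G ⧸ B) × S | p.2 ∈ S₀})).Subsingleton := by
      intro y z hz z' hz'
      have hzU : z ∈ (A₀ ×ˢ U) ∩ {p : (G ⧸ B) × S | p.2 ∈ S₀} := ⟨⟨hz.2.1.1, (hVU hz.2.1.2).1⟩, hz.2.2⟩
      have hz'U : z' ∈ (A₀ ×ˢ U) ∩ {p : (G ⧸ B) × S | p.2 ∈ S₀} := ⟨⟨hz'.2.1.1, (hVU hz'.2.1.2).1⟩, hz'.2.2⟩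
      exact hinjU hzU hz'U ((mem_singleton_iff.1 (mem_preimage.1 hz.1)).trans (mem_singleton_iff.1 (mem_preimage.1 hz'.1)).symm)
    have hcount : ∀ y, Measure.count (Ψ ⁻¹' {y} ∩ (A₀ ×ˢ V ∩ {p : (G ⧸ B) × S | p.2 ∈ S₀})) = (Ψ '' (A₀ ×ˢ V)).indicator 1 y := by
      intro y
      by_cases hy : y ∈ Ψ '' (A₀ ×ˢ V)
      · obtain ⟨p, hp, rfl⟩ := hy
        have hmem : p ∈ Ψ ⁻¹' {Ψ p} ∩ (A₀ ×ˢ V ∩ {p : (G ⧸ B) × S | p.2 ∈ S₀}) := ⟨rfl, hp, hEsub hp⟩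
        rw [(hsub (Ψ p)).eq_singleton_of_mem hmem, Measure.count_singleton, indicator_of_mem (mem_image_of_mem Ψ hp), Pi.one_apply]
      · have hempty : Ψ ⁻¹' {y} ∩ (A₀ ×ˢ V ∩ {p : (G ⧸ B) × S | p.2 ∈ S₀}) = ∅ :=
          eq_empty_of_forall_notMem fun p hp => hy ⟨p, hp.2.1, hp.1⟩
        rw [hempty, measure_empty, indicator_of_notMem hy]
    have hμE : μ (A₀ ×ˢ V) = ν (Ψ '' (A₀ ×ˢ V)) := by
      rw [hμ _ hE, lintegral_congr fun y => hcount y, lintegral_indicator_one hEim]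
    have hμE' : μ (A₀ ×ˢ V) = (quotientMeasure B bm hB ν) A₀ * σ V := by
      rw [← hprod, Measure.prod_prod]
    rw [← hμE, hμE'] at h3
    exact (ENNReal.mul_right_inj hA₀0 hA₀top).1 h3
  -- §d near every point of `S₀`, `σ = W · λ`
  have hnbhd : ∀ s₀ ∈ S₀, ∃ U : Set S, IsOpen U ∧ s₀ ∈ U ∧ σ.restrict (U ∩ S₀) = (lam.withDensity W).restrict (U ∩ S₀) := by
    intro s₀ hs₀
    obtain ⟨U, hUo, hs₀U, A₀, hA₀m, hA₀0, hA₀top, hinjU, hJ'⟩ := hJac s₀ hs₀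
    refine ⟨U, hUo, hs₀U, ?_⟩
    ext V hV
    have hVm : MeasurableSet (V ∩ (U ∩ S₀)) := hV.inter (hUo.measurableSet.inter hS₀)
    rw [Measure.restrict_apply hV, Measure.restrict_apply hV, withDensity_apply _ hVm]
    exact htube A₀ hA₀m hA₀0 hA₀top U hinjU _ hVm inter_subset_right (hJ' _ hVm inter_subset_right)
  have hident := restrict_eq_restrict_of_forall_nhds hnbhd
  -- §e assembly
  intro f hf
  have hσS : σ = σ.restrict S₀ := by
    refine (Measure.restrict_eq_self_of_ae_mem ?_).symm
    rw [ae_iff]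
    exact measure_mono_null (fun s hs => hs) hσcar
  have hOm : Measurable fun s : S => ∫⁻ q, f (Ψ (q, s)) ∂(quotientMeasure B bm hB ν) :=
    Measurable.lintegral_prod_left' (μ := (quotientMeasure B bm hB ν)) (hf.comp hΨc.measurable)
  rw [hformula f hf, hσS, hident, restrict_withDensity hS₀, lintegral_withDensity_eq_lintegral_mul _ hW hOm]
  rfl

/-! ## §2 The Bochner form -/

include hΨc hΨ hS₀ hinj hw in
/-- **The Bochner ∕ Banach-valued form**: under the same LOCAL TUBE JACOBIAN BY SHAPE with a real weight `W : S → ℝ≥0`, for every `g : G → E` that is `ν`-integrable on `Ψ(D)`,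
`(s, q) ↦ g(Ψ(q, s))` is integrable for `((λ|_{S₀}) · W) ⊗ μ₀` and **`∫_{s ∈ S₀} W(s) • ∫_{G ⧸ B} g(Ψ(q, s)) dμ₀ dλ = w • ∫_{Ψ(D)} g dν`** (★ `integrable_and_integral_eq_smul_of_lintegral_radial`
along §1, then `integral_withDensity_eq_integral_smul`). [cite: HarishChandra1970, Lemma 42] [cite: Rogawski1990, §12.5 pp. 182, 186] [cite: Federer1969, §2.10.10] -/
theorem integrable_and_integral_eq_of_tubeJacobian_local [SigmaFinite lam] (W : S → ℝ≥0) (hW : Measurable W)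
    (hJac : ∀ s₀ ∈ S₀, ∃ U : Set S, IsOpen U ∧ s₀ ∈ U ∧
      ∃ A₀ : Set (G ⧸ B), MeasurableSet A₀ ∧ (quotientMeasure B bm hB ν) A₀ ≠ 0 ∧ (quotientMeasure B bm hB ν) A₀ ≠ ⊤ ∧
        InjOn Ψ ((A₀ ×ˢ U) ∩ {p : (G ⧸ B) × S | p.2 ∈ S₀}) ∧
        ∀ V : Set S, MeasurableSet V → V ⊆ U ∩ S₀ →
          ν (Ψ '' (A₀ ×ˢ V)) = (quotientMeasure B bm hB ν) A₀ * ∫⁻ s in V, (W s : ℝ≥0∞) ∂lam)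
    {E : Type*} [NormedAddCommGroup E] [NormedSpace ℝ E]
    (g : G → E) (hg : IntegrableOn g (Ψ '' {p : (G ⧸ B) × S | p.2 ∈ S₀}) ν) :
    Integrable (fun p : S × (G ⧸ B) => g (Ψ (p.2, p.1)))
        (((lam.restrict S₀).withDensity fun s => (W s : ℝ≥0∞)).prod (quotientMeasure B bm hB ν)) ∧
      ∫ s in S₀, (W s : ℝ) • ∫ q, g (Ψ (q, s)) ∂(quotientMeasure B bm hB ν) ∂lam =
        (w : ℝ) • ∫ y in Ψ '' {p : (G ⧸ B) × S | p.2 ∈ S₀}, g y ∂ν := by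
  have hWe : Measurable fun s : S => (W s : ℝ≥0∞) := hW.coe_nnreal_ennreal
  have hmain := lintegral_image_eq_lintegral_weight_of_tubeJacobian_local B hB ν Ψ hΨc e hΨ S₀ hS₀ hinj w hw bm lam (fun s => (W s : ℝ≥0∞)) hWe hJac
  haveI : IsClosed (B : Set G) := hB
  haveI : SecondCountableTopology (G ⧸ B) := (QuotientGroup.isQuotientMap_mk _).secondCountableTopology QuotientGroup.isOpenMap_coe
  haveI : LocallyCompactSpace (G ⧸ B) := QuotientGroup.instLocallyCompactSpace _
  haveI : SigmaCompactSpace (G ⧸ B) := sigmaCompactSpace_of_locallyCompact_secondCountable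
  haveI : SigmaFinite (quotientMeasure B bm hB ν) := SigmaFinite.of_isFiniteMeasureOnCompacts _
  haveI : SigmaFinite ((lam.restrict S₀).withDensity fun s => (W s : ℝ≥0∞)) :=
    SigmaFinite.withDensity_of_ne_top (ae_of_all _ fun _ => ENNReal.coe_ne_top)
  have hmain' : ∀ f : G → ℝ≥0∞, Measurable f →
      (w : ℝ≥0∞) * ∫⁻ y in Ψ '' {p : (G ⧸ B) × S | p.2 ∈ S₀}, f y ∂ν =
        ∫⁻ s, ∫⁻ q, f (Ψ (q, s)) ∂(quotientMeasure B bm hB ν) ∂((lam.restrict S₀).withDensity fun s => (W s : ℝ≥0∞)) := by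
    intro f hf
    have hOm : Measurable fun s : S => ∫⁻ q, f (Ψ (q, s)) ∂(quotientMeasure B bm hB ν) :=
      Measurable.lintegral_prod_left' (μ := (quotientMeasure B bm hB ν)) (hf.comp hΨc.measurable)
    rw [hmain f hf, lintegral_withDensity_eq_lintegral_mul _ hWe hOm]
    rfl
  obtain ⟨hint, heq⟩ := integrable_and_integral_eq_smul_of_lintegral_radial hΨc.measurable hmain' g hg
  refine ⟨hint, ?_⟩
  rw [← heq, integral_withDensity_eq_integral_smul hW]
  rfl

end TubeJacobian

end Summit.HodgeConjecture.HodgeConjecture.R90.S4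

end
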